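import Summits.Schanuel.Schanuel.Theorems.RootDecomp1BQuadFrame02

/-!
# RootDecomp1BQuadFrame — lens 4, generation 36 ADDENDUM «QUADRATIC FRAMES» (B-R23 (ii)(b)): the (1|ρ) At-cells and 5 ≤ polarDeg (1, ρ) for EVERY ρ ∈ `QuadHyperLiouville` (hyper-approximable by real quadratic irrationals) modulo `Roy2014_thm_1_1` ONLY, with the NAMED member ρ_Q = √2 + λ_H of FINITE irrationality exponent — continuation (RootDecomp1BQuadFrame03): §E THE ENGINE `algebraicIndependent_cons_of_quadFrameMeasure` on the quadratic frame

(lens-4 g36 ADDENDUM `QuadFrame.lean` [HOME/decomp-schanuel-lens-4/g36/ sha256 ffb0c3af…, 1516 l; NODE L1950 / REQUEST L1951; critic VERDICT L1957 (B-R23 (ii)(b) cell credit, RULE B-R24, port GO)]; port by census-1 gen 17 as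
`RootDecomp1BQuadFrame01`–`05` — see the PORT NOTE of part 01; `--supports stmt-Schanuel-32406`; rung 0.)
-/

noncomputable section

open Complex IntermediateField MvPolynomial

namespace Summit.Schanuel.Schanuel.Theorems.RootDecomp1BQuadFrame

open Summit.Schanuel.Schanuel.Theorems.RootDecomp1EPointTransfer (Roy2014_thm_1_1)
open Summit.Schanuel.Schanuel.Theorems.RootDecomp1KHyper (mvlen mvlen_nonneg abs_coeff_le_mvlen one_le_mvlen
  exists_ball_eval_ne_zero mvlen_add_le mvlen_sub_le mvlen_mul_le mvlen_C_mul_le mvlen_sum_le)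
open Summit.Schanuel.Schanuel.Theorems.RootDecomp1BHyperFrame (royDeg royS RoyNF roy_tree_iff framePt Ff
  Ff_eq_aeval exists_lipschitz_Ff gcoef gcoef_ne_zero apply_zero_le_totalDegree engine_endgame
  trdeg_adjoin_le_of_isAlgebraic' linearIndependent_one_irrational)
open Summit.Schanuel.Schanuel.Theorems.RootDecomp1BFedFlagCore (KleinIH polarDeg polarField)
open Summit.Schanuel.Schanuel.Theorems.RootDecomp1BDefectFloorDefs (SharpRelativeLindemannAt TameDefectZeroAt
  WildSharpDefectZeroAt WildSharpDefectZeroInitAt WildSharpInitAt)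
open Summit.Schanuel.Schanuel.Theorems.RootDecomp1BDefectFloorCells (natCast_le_trdeg_of_algebraicIndependent)
open Summit.Schanuel.Schanuel.Theorems.RootDecomp1BRadicalDescent (exists_int_relation norm_mvaeval_le_mvlen)
open Summit.Schanuel.Schanuel.Theorems.RootDecomp1BMovingZero (mem_polarField_one mem_polarField_swap)

/-! ## §E  THE ENGINE on the quadratic frame -/

section Engine

/-- `exp(−x) < δ` once `x > δ⁻¹` (`δ > 0`). -/
private theorem exp_neg_lt_of_inv_lt_QF {δ x : ℝ} (hδ : 0 < δ) (hx : δ⁻¹ < x) : Real.exp (-x) < δ := by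
  rw [Real.exp_neg, inv_lt_comm₀ (Real.exp_pos _) hδ]
  linarith [Real.add_one_le_exp x]

/-- `x^k ≤ exp (k x)` for `x ≥ 0`. -/
private theorem pow_le_exp_mul_QF {x : ℝ} (hx : 0 ≤ x) (k : ℕ) : x ^ k ≤ Real.exp (k * x) := by
  rw [Real.exp_nat_mul]
  exact pow_le_pow_left₀ hx (by linarith [Real.add_one_le_exp x]) k

/-- `(2x²)^k ≤ exp (2 k x)` for `x ≥ 0`. -/
private theorem two_sq_pow_le_exp {x : ℝ} (hx : 0 ≤ x) (k : ℕ) :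
    (2 * x * x) ^ k ≤ Real.exp (2 * k * x) := by
  have h1 : 2 * x * x ≤ Real.exp (2 * x) := by
    have h := Real.quadratic_le_exp_of_nonneg (by linarith : (0 : ℝ) ≤ 2 * x)
    nlinarith
  calc (2 * x * x) ^ k ≤ Real.exp (2 * x) ^ k := pow_le_pow_left₀ (by positivity) h1 k
    _ = Real.exp (2 * k * x) := by rw [← Real.exp_nat_mul]; ring_nf

/-- size of the frame point: `‖e^{α_{β,j}}‖ ≤ e^{R₁}` once `|β| ≤ R₁`, `R₁ ≥ 1`. -/
theorem norm_exp_qpt_le {β R₁ : ℝ} (hβ : |β| ≤ R₁) (h1 : 1 ≤ R₁) (j : Fin 4) :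
    ‖cexp (qpt β j)‖ ≤ Real.exp R₁ := by
  have hz : ‖qpt β j‖ ≤ R₁ := by
    rw [qpt_apply]
    fin_cases j
    · simpa using h1
    · simpa [Complex.norm_real, Real.norm_eq_abs] using hβ
    · simpa using h1
    · simpa [Complex.norm_real, Real.norm_eq_abs] using hβ
  calc ‖cexp (qpt β j)‖ = Real.exp (qpt β j).re := Complex.norm_exp _
    _ ≤ Real.exp ‖qpt β j‖ := Real.exp_le_exp.mpr (Complex.re_le_norm _)
    _ ≤ Real.exp R₁ := Real.exp_le_exp.mpr hz

set_option maxHeartbeats 1600000 in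
/-- **THE ENGINE (quadratic frame).**  The quadratic frame measure and `ρ ∈ QuadHyperLiouville` make
`ρ, e, e^{ρ}, e^{i}, e^{iρ}` algebraically independent over ℚ.  Shape of the proof: an integer relation
`P(ρ, e^{α_ρ}) = 0`; at a very close quadratic approximant `β` the NORM FORM `Q_β = (U + aβ·V)(U + aβ′·V) ∈ ℤ[X₁..X₄]`
of `a^d P(β, X)` is non-zero (irrationality of `aβ, aβ′` + the grouped coefficient `g(β) ≠ 0`), has height
`≤ 3A²(len P)²(2A²)^{2d}`, and `|Q_β(e^{α_β})| ≤ A^d |F(β)| · 3A R₁ len(P) (2A²)^d e^{dR₁}` with `|F(β)| ≤ Kl e^{−A^m}`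
(Lipschitz, `F(ρ) = 0`) — against the measure's `exp(−C(log H + A^N))`; the endgame is `engine_endgame`. -/
theorem algebraicIndependent_cons_of_quadFrameMeasure (hF : QuadFrameMeasure) {ρ : ℝ}
    (hρ : QuadHyperLiouville ρ) :
    AlgebraicIndependent ℚ (Fin.cons (ρ : ℂ) (fun j => cexp (qpt ρ j)) : Fin (4 + 1) → ℂ) := by
  classical
  by_contra hdep
  obtain ⟨P, hP0, hPρ⟩ := exists_int_relation hdep
  have hFρ : Ff P qy qe ρ = 0 := by rw [Ff_eq_aeval, framePt_qy_qe]; exact hPρ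
  obtain ⟨Kl, δ₁, hKl, hδ₁, hlip⟩ := exists_lipschitz_Ff P qy qe ρ
  -- the nonvanishing radius of the grouped coefficient
  obtain ⟨s₀, hs₀⟩ := MvPolynomial.ne_zero_iff.mp hP0
  have hs₀' : s₀ ∈ P.support := MvPolynomial.mem_support_iff.mpr hs₀
  obtain ⟨g, hg⟩ : ∃ g : Polynomial ℂ, g = (gcoef P (Finsupp.tail s₀)).map (Int.castRingHom ℂ) :=
    ⟨_, rfl⟩
  have hg0 : g ≠ 0 := by
    rw [hg]
    exact (Polynomial.map_ne_zero_iff (Int.castRingHom ℂ).injective_int).mpr (gcoef_ne_zero P hs₀')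
  obtain ⟨δ, hδ, hball⟩ := exists_ball_eval_ne_zero g hg0 ρ
  -- the degree and the measure in degree `2d`
  obtain ⟨d, hdP⟩ : ∃ d : ℕ, d = P.totalDegree := ⟨_, rfl⟩
  have hd : ∀ s ∈ P.support, s 0 ≤ d := fun s hs => hdP ▸ apply_zero_le_totalDegree P hs
  obtain ⟨C₀, N, hC, hFM⟩ := hF (2 * d)
  -- the real constants (independent of the approximant)
  obtain ⟨L, hL⟩ : ∃ L : ℝ, L = ((mvlen P : ℤ) : ℝ) := ⟨_, rfl⟩
  have hL1 : 1 ≤ L := by rw [hL]; exact_mod_cast one_le_mvlen hP0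
  have hL0 : 0 < L := lt_of_lt_of_le zero_lt_one hL1
  have hlogL : 0 ≤ Real.log L := Real.log_nonneg hL1
  obtain ⟨R₁, hR₁⟩ : ∃ R₁ : ℝ, R₁ = |ρ| + 1 := ⟨_, rfl⟩
  have hR₁1 : 1 ≤ R₁ := by rw [hR₁]; linarith [abs_nonneg ρ]
  have hR₁0 : 0 ≤ R₁ := le_trans zero_le_one hR₁1
  have hd0 : (0 : ℝ) ≤ d := Nat.cast_nonneg _
  obtain ⟨ℓ, hℓ⟩ : ∃ ℓ : ℝ, ℓ = 2 * Real.log L := ⟨_, rfl⟩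
  have hℓ0 : 0 ≤ ℓ := by rw [hℓ]; positivity
  obtain ⟨d₁, hd₁⟩ : ∃ d₁ : ℝ, d₁ = 4 + 6 * d + 3 * R₁ := ⟨_, rfl⟩
  have hd₁0 : 0 ≤ d₁ := by rw [hd₁]; positivity
  obtain ⟨K₁, hK₁⟩ : ∃ K₁ : ℝ, K₁ = Kl + Real.log L + d * R₁ := ⟨_, rfl⟩
  have hK₁0 : 0 ≤ K₁ := by rw [hK₁]; positivity
  obtain ⟨Γ, hΓ⟩ : ∃ Γ : ℝ, Γ = C₀ * ℓ + C₀ * d₁ * 1 + C₀ * 1 ^ N + d₁ + K₁ + 1 := ⟨_, rfl⟩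
  obtain ⟨k, hk⟩ : ∃ k : ℕ, Γ < 2 ^ k := pow_unbounded_of_one_lt Γ one_lt_two
  obtain ⟨m₁, hm₁⟩ : ∃ m₁ : ℕ, δ₁⁻¹ + δ⁻¹ + 1 < m₁ := exists_nat_gt _
  obtain ⟨m, hm⟩ : ∃ m : ℕ, m = N + 1 + k + m₁ + 2 := ⟨_, rfl⟩
  -- the approximant
  obtain ⟨β, a, b, c, A, hmA, hirr, ha0, hβ, haA, hbA, hcA, hne, hlt⟩ := hρ m
  have hb2 : 2 ≤ A := le_trans (by omega) hmA
  have hA1 : (1 : ℝ) ≤ A := by exact_mod_cast le_trans one_le_two hb2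
  have hA0 : (0 : ℝ) ≤ A := le_trans zero_le_one hA1
  have hA1Z : (1 : ℤ) ≤ A := by exact_mod_cast le_trans one_le_two hb2
  have haR : |(a : ℝ)| ≤ A := by exact_mod_cast haA
  have hbR : |(b : ℝ)| ≤ A := by exact_mod_cast hbA
  have hβC : (a : ℂ) * ((β : ℝ) : ℂ) ^ 2 + b * ((β : ℝ) : ℂ) + c = 0 := by exact_mod_cast hβ
  have hbm : (m₁ : ℝ) ≤ (A : ℝ) ^ m := by
    have h1 : (m₁ : ℝ) ≤ A := by exact_mod_cast le_trans (by omega) hmA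
    exact h1.trans (le_self_pow₀ hA1 (by omega))
  have hsmall : |ρ - β| < Real.exp (-(m₁ : ℝ)) :=
    hlt.trans_le (Real.exp_le_exp.mpr (neg_le_neg hbm))
  have hδinv : 0 < δ⁻¹ := inv_pos.mpr hδ
  have hδ₁inv : 0 < δ₁⁻¹ := inv_pos.mpr hδ₁
  have hdist₁ : |β - ρ| < δ₁ := by
    rw [abs_sub_comm]; exact hsmall.trans (exp_neg_lt_of_inv_lt_QF hδ₁ (by linarith))
  have hdist : |β - ρ| < δ := by
    rw [abs_sub_comm]; exact hsmall.trans (exp_neg_lt_of_inv_lt_QF hδ (by linarith))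
  have hdist1 : |ρ - β| < 1 := hsmall.trans_le (Real.exp_le_one_iff.mpr (by simp))
  have hβabs : |β| ≤ R₁ := by
    have h := abs_sub_abs_le_abs_sub β ρ
    rw [abs_sub_comm] at hdist1
    rw [hR₁]; linarith
  -- the point and its size
  obtain ⟨θ, hθ⟩ : ∃ θ : Fin 4 → ℂ, θ = fun j => cexp (qpt β j) := ⟨_, rfl⟩
  have hθM : ∀ j, ‖θ j‖ ≤ Real.exp R₁ := fun j => by rw [hθ]; exact norm_exp_qpt_le hβabs hR₁1 j
  have hM1 : 1 ≤ Real.exp R₁ := by linarith [Real.add_one_le_exp R₁]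
  -- the conjugates `γ = aβ`, `γ′ = −b − aβ`
  obtain ⟨γ, hγ⟩ : ∃ γ : ℝ, γ = a * β := ⟨_, rfl⟩
  obtain ⟨γ', hγ'⟩ : ∃ γ' : ℝ, γ' = -b - a * β := ⟨_, rfl⟩
  have hγirr : Irrational γ := by rw [hγ]; exact hirr.intCast_mul ha0
  have hγ'irr : Irrational γ' := by
    have h := (hirr.intCast_mul ha0).intCast_sub (-b)
    rw [hγ']
    push_cast at h
    convert h using 1
  have hγC : (γ : ℂ) = (a : ℂ) * ((β : ℝ) : ℂ) := by rw [hγ]; push_cast; ring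
  have hγ'C : (γ' : ℂ) = -(b : ℂ) - (a : ℂ) * ((β : ℝ) : ℂ) := by rw [hγ']; push_cast; ring
  have hγeq : (γ : ℂ) ^ 2 + (b : ℂ) * (γ : ℂ) + (a : ℂ) * (c : ℂ) = 0 := by
    rw [hγC]; linear_combination (a : ℂ) * hβC
  have hγR : γ ^ 2 + (b : ℝ) * γ + (a : ℝ) * (c : ℝ) = 0 := by exact_mod_cast hγeq
  have hsum : γ + γ' = -b := by rw [hγ, hγ']; ring
  have hprodγ : γ * γ' = a * c := by
    rw [hγ'] at *
    rw [hγ] at hγR ⊢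
    linear_combination -hγR
  -- the norm form `Q` and its evaluation
  obtain ⟨Q, hQ⟩ : ∃ Q : MvPolynomial (Fin 4) ℤ, Q = Qpol a b c P d := ⟨_, rfl⟩
  have hF1 : aeval θ (Upol a b c P d) + (γ : ℂ) * aeval θ (Vpol a b c P d) =
      (a : ℂ) ^ d * Ff P qy qe β := by
    rw [hγC, aeval_U_add_mul_V a b c P d θ hβC hd, Ff_eq_aeval, framePt_qy_qe, hθ]
  have hQeval : aeval θ Q = ((a : ℂ) ^ d * Ff P qy qe β) *
      (aeval θ (Upol a b c P d) + (γ' : ℂ) * aeval θ (Vpol a b c P d)) := by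
    rw [hQ, aeval_Qpol a b c P d θ hγeq, hF1, hγ'C, hγC]
  -- `Q ≠ 0`
  have key : ∀ γ₀ : ℝ, Irrational γ₀ →
      MvPolynomial.map (Int.castRingHom ℝ) (Upol a b c P d) +
        C γ₀ * MvPolynomial.map (Int.castRingHom ℝ) (Vpol a b c P d) = 0 → False := by
    intro γ₀ hγ₀ h1
    have hUV := UV_eq_zero_of_coeff a b c P d hγ₀ (fun s => by
      have h2 := congrArg (MvPolynomial.coeff s) h1
      simp only [MvPolynomial.coeff_add, MvPolynomial.coeff_C_mul, MvPolynomial.coeff_map,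
        MvPolynomial.coeff_zero, eq_intCast] at h2
      have h3 := congrArg (fun x : ℝ => (x : ℂ)) h2
      push_cast at h3
      exact h3)
    have h4 := coeff_U_add_mul_V a b c P d (Finsupp.tail s₀) hβC hd
    rw [hUV.1, hUV.2, MvPolynomial.coeff_zero, Int.cast_zero, mul_zero, add_zero, ← hg] at h4
    rcases mul_eq_zero.mp h4.symm with h5 | h5
    · exact pow_ne_zero d (by exact_mod_cast ha0 : (a : ℂ) ≠ 0) h5
    · exact hball β hne hdist h5
  have hQ0 : Q ≠ 0 := by
    intro hQ0
    have hfac : MvPolynomial.map (Int.castRingHom ℝ) Q =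
        (MvPolynomial.map (Int.castRingHom ℝ) (Upol a b c P d) +
          C γ * MvPolynomial.map (Int.castRingHom ℝ) (Vpol a b c P d)) *
        (MvPolynomial.map (Int.castRingHom ℝ) (Upol a b c P d) +
          C γ' * MvPolynomial.map (Int.castRingHom ℝ) (Vpol a b c P d)) := by
      rw [hQ]
      unfold Qpol
      simp only [map_add, map_sub, map_mul, MvPolynomial.map_C]
      simp only [eq_intCast]
      have hC1 : (C (b : ℝ) : MvPolynomial (Fin 4) ℝ) = -(C γ + C γ') := by
        rw [← map_add, hsum, map_neg, neg_neg]
      have hC2 : (C (a : ℝ) * C (c : ℝ) : MvPolynomial (Fin 4) ℝ) = C γ * C γ' := by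
        rw [← map_mul, ← map_mul, hprodγ]
      rw [hC1, hC2]
      ring
    have hzero := hfac.symm.trans (by rw [hQ0, map_zero])
    rcases mul_eq_zero.mp hzero with h1 | h1
    · exact key γ hγirr h1
    · exact key γ' hγ'irr h1
  -- the height of `Q`
  obtain ⟨Hz, hHz⟩ : ∃ Hz : ℤ, Hz = 3 * (A : ℤ) * A * (mvlen P * (2 * (A : ℤ) * A) ^ d) ^ 2 := ⟨_, rfl⟩
  have hX1 : (1 : ℤ) ≤ mvlen P * (2 * (A : ℤ) * A) ^ d :=
    one_le_mul_of_one_le_of_one_le (one_le_mvlen hP0) (one_le_pow₀ (by nlinarith))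
  have hHz1 : 1 ≤ Hz := by
    rw [hHz]
    have h3 : (1 : ℤ) ≤ 3 * (A : ℤ) * A := by nlinarith
    have h4 : (1 : ℤ) ≤ (mvlen P * (2 * (A : ℤ) * A) ^ d) ^ 2 := one_le_pow₀ hX1
    exact one_le_mul_of_one_le_of_one_le h3 h4
  obtain ⟨H, hH⟩ : ∃ H : ℕ, H = Hz.toNat := ⟨_, rfl⟩
  have hHZ : (H : ℤ) = Hz := by rw [hH]; exact Int.toNat_of_nonneg (by linarith)
  have hH1 : 1 ≤ H := by
    have h : (1 : ℤ) ≤ (H : ℤ) := by rw [hHZ]; exact hHz1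
    exact_mod_cast h
  have hHpos : (0 : ℝ) < H := by exact_mod_cast (lt_of_lt_of_le zero_lt_one hH1)
  have hcoef : ∀ s, |Q.coeff s| ≤ (H : ℤ) := fun s => by
    rw [hHZ, hHz, hQ]
    exact (abs_coeff_le_mvlen _ s).trans (mvlen_Qpol_le a b c P d hA1Z haA hbA hcA hd)
  have hHR : (H : ℝ) = 3 * A * A * (L * (2 * A * A) ^ d) ^ 2 := by
    have h1 : (H : ℝ) = ((Hz : ℤ) : ℝ) := by rw [← hHZ, Int.cast_natCast]
    rw [h1, hHz, hL]; push_cast; ring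
  have hlogH : Real.log H ≤ ℓ + (4 + 4 * d) * A := by
    have h3A : 3 * (A : ℝ) * A ≤ Real.exp (4 * A) := by
      have h := Real.quadratic_le_exp_of_nonneg (by positivity : (0 : ℝ) ≤ 4 * A)
      nlinarith
    have h2A : (2 * (A : ℝ) * A) ^ d ≤ Real.exp (2 * d * A) := two_sq_pow_le_exp hA0 d
    have hLexp : Real.exp (Real.log L) = L := Real.exp_log hL0
    have hHle : (H : ℝ) ≤ Real.exp (ℓ + (4 + 4 * d) * A) := by
      rw [hHR]
      have hLW : L * (2 * A * A) ^ d ≤ Real.exp (Real.log L) * Real.exp (2 * d * A) := by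
        rw [hLexp]; exact mul_le_mul_of_nonneg_left h2A hL0.le
      have hLW2 : (L * (2 * A * A) ^ d) ^ 2 ≤ (Real.exp (Real.log L) * Real.exp (2 * d * A)) ^ 2 :=
        pow_le_pow_left₀ (by positivity) hLW 2
      calc 3 * (A : ℝ) * A * (L * (2 * A * A) ^ d) ^ 2
          ≤ Real.exp (4 * A) * (Real.exp (Real.log L) * Real.exp (2 * d * A)) ^ 2 :=
            mul_le_mul h3A hLW2 (by positivity) (Real.exp_pos _).le
        _ = Real.exp (ℓ + (4 + 4 * d) * A) := by
            simp only [sq, ← Real.exp_add]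
            congr 1
            rw [hℓ]; ring
    exact (Real.log_le_iff_le_exp hHpos).mpr hHle
  -- THE MEASURE at `Q`
  have hQdeg : Q.totalDegree ≤ 2 * d := by
    rw [hQ]; exact (totalDegree_Qpol_le a b c P d).trans (le_of_eq (by rw [hdP]))
  have hlow := hFM β a b c A hirr ha0 hβ haA hbA hcA Q hQ0 hQdeg H hH1 hcoef
  rw [← hθ] at hlow
  -- THE SMALLNESS of the first factor, the size of the second
  have hF1n : ‖(a : ℂ) ^ d * Ff P qy qe β‖ ≤ (A : ℝ) ^ d * (Kl * Real.exp (-((A : ℝ) ^ m))) := by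
    rw [norm_mul, norm_pow, Complex.norm_intCast]
    have h1 := hlip β hdist₁
    rw [hFρ, sub_zero] at h1
    have h2 : ‖Ff P qy qe β‖ ≤ Kl * Real.exp (-((A : ℝ) ^ m)) :=
      h1.trans (mul_le_mul_of_nonneg_left (by rw [abs_sub_comm]; exact hlt.le) hKl)
    exact mul_le_mul (pow_le_pow_left₀ (abs_nonneg _) haR d) h2 (norm_nonneg _) (by positivity)
  obtain ⟨hUlen, hVlen⟩ := mvlen_UV_le a b c P d hA1Z haA hbA hcA hd
  obtain ⟨hUdeg, hVdeg⟩ := totalDegree_UV_le a b c P d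
  have hlenR : ∀ {X : MvPolynomial (Fin 4) ℤ}, mvlen X ≤ mvlen P * (2 * (A : ℤ) * A) ^ d →
      ((mvlen X : ℤ) : ℝ) ≤ L * (2 * A * A) ^ d := by
    intro X hX
    have : ((mvlen X : ℤ) : ℝ) ≤ ((mvlen P * (2 * (A : ℤ) * A) ^ d : ℤ) : ℝ) := by exact_mod_cast hX
    rw [hL]; push_cast at this ⊢; exact this
  have hUn : ‖aeval θ (Upol a b c P d)‖ ≤ L * (2 * A * A) ^ d * Real.exp R₁ ^ d :=
    (norm_mvaeval_le_mvlen (Upol a b c P d) θ hM1 hθM).trans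
      (mul_le_mul (hlenR hUlen) (pow_le_pow_right₀ hM1 (hUdeg.trans (le_of_eq hdP.symm)))
        (by positivity) (by positivity))
  have hVn : ‖aeval θ (Vpol a b c P d)‖ ≤ L * (2 * A * A) ^ d * Real.exp R₁ ^ d :=
    (norm_mvaeval_le_mvlen (Vpol a b c P d) θ hM1 hθM).trans
      (mul_le_mul (hlenR hVlen) (pow_le_pow_right₀ hM1 (hVdeg.trans (le_of_eq hdP.symm)))
        (by positivity) (by positivity))
  have hγ'abs : |γ'| ≤ 2 * A * R₁ := by
    rw [hγ']
    calc |-(b : ℝ) - a * β| ≤ |(-(b : ℝ))| + |(a : ℝ) * β| := abs_sub _ _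
      _ = |(b : ℝ)| + |(a : ℝ)| * |β| := by rw [abs_neg, abs_mul]
      _ ≤ A + A * R₁ := add_le_add hbR (mul_le_mul haR hβabs (abs_nonneg _) hA0)
      _ ≤ 2 * A * R₁ := by nlinarith
  have hXnn : 0 ≤ L * (2 * A * A) ^ d * Real.exp R₁ ^ d := by positivity
  have hF2n : ‖aeval θ (Upol a b c P d) + (γ' : ℂ) * aeval θ (Vpol a b c P d)‖ ≤
      3 * A * R₁ * (L * (2 * A * A) ^ d * Real.exp R₁ ^ d) := by
    calc ‖aeval θ (Upol a b c P d) + (γ' : ℂ) * aeval θ (Vpol a b c P d)‖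
        ≤ ‖aeval θ (Upol a b c P d)‖ + ‖(γ' : ℂ) * aeval θ (Vpol a b c P d)‖ := norm_add_le _ _
      _ = ‖aeval θ (Upol a b c P d)‖ + |γ'| * ‖aeval θ (Vpol a b c P d)‖ := by
          rw [norm_mul, Complex.norm_real, Real.norm_eq_abs]
      _ ≤ L * (2 * A * A) ^ d * Real.exp R₁ ^ d + (2 * A * R₁) * (L * (2 * A * A) ^ d * Real.exp R₁ ^ d) :=
          add_le_add hUn (mul_le_mul hγ'abs hVn (norm_nonneg _) (by positivity))
      _ ≤ 3 * A * R₁ * (L * (2 * A * A) ^ d * Real.exp R₁ ^ d) := by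
          have h1 : (1 : ℝ) ≤ A * R₁ := by nlinarith
          nlinarith
  have hprod : ‖aeval θ Q‖ ≤ ((A : ℝ) ^ d * (Kl * Real.exp (-((A : ℝ) ^ m)))) *
      (3 * A * R₁ * (L * (2 * A * A) ^ d * Real.exp R₁ ^ d)) := by
    rw [hQeval, norm_mul]
    exact mul_le_mul hF1n hF2n (norm_nonneg _) (by positivity)
  -- everything in exponential form
  have hup : ((A : ℝ) ^ d * (Kl * Real.exp (-((A : ℝ) ^ m)))) *
      (3 * A * R₁ * (L * (2 * A * A) ^ d * Real.exp R₁ ^ d)) ≤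
      Real.exp (d * A + Kl - (A : ℝ) ^ m + 3 * A * R₁ + Real.log L + 2 * d * A + d * R₁) := by
    have e1 : (A : ℝ) ^ d ≤ Real.exp (d * A) := pow_le_exp_mul_QF hA0 d
    have e2 : Kl ≤ Real.exp Kl := by linarith [Real.add_one_le_exp Kl]
    have e3 : 3 * A * R₁ ≤ Real.exp (3 * A * R₁) := by linarith [Real.add_one_le_exp (3 * A * R₁)]
    have e4 : L ≤ Real.exp (Real.log L) := by rw [Real.exp_log hL0]
    have e5 : (2 * (A : ℝ) * A) ^ d ≤ Real.exp (2 * d * A) := two_sq_pow_le_exp hA0 d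
    have e6 : Real.exp R₁ ^ d = Real.exp (d * R₁) := (Real.exp_nat_mul R₁ d).symm
    have T1 : (A : ℝ) ^ d * (Kl * Real.exp (-((A : ℝ) ^ m))) ≤
        Real.exp (d * A) * (Real.exp Kl * Real.exp (-((A : ℝ) ^ m))) :=
      mul_le_mul e1 (mul_le_mul_of_nonneg_right e2 (Real.exp_pos _).le)
        (mul_nonneg hKl (Real.exp_pos _).le) (Real.exp_pos _).le
    have T2 : 3 * A * R₁ * (L * (2 * A * A) ^ d * Real.exp R₁ ^ d) ≤
        Real.exp (3 * A * R₁) * (Real.exp (Real.log L) * Real.exp (2 * d * A) * Real.exp (d * R₁)) := by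
      rw [← e6]
      exact mul_le_mul e3 (mul_le_mul_of_nonneg_right (mul_le_mul e4 e5 (by positivity) (Real.exp_pos _).le)
        (by positivity)) hXnn (Real.exp_pos _).le
    calc _ ≤ Real.exp (d * A) * (Real.exp Kl * Real.exp (-((A : ℝ) ^ m))) *
          (Real.exp (3 * A * R₁) * (Real.exp (Real.log L) * Real.exp (2 * d * A) * Real.exp (d * R₁))) :=
          mul_le_mul T1 T2 (by positivity) (by positivity)
      _ = Real.exp (d * A + Kl - (A : ℝ) ^ m + 3 * A * R₁ + Real.log L + 2 * d * A + d * R₁) := by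
          simp only [← Real.exp_add]
          congr 1
          ring
  have hchain := Real.exp_le_exp.mp (hlow.trans (hprod.trans hup))
  -- the exponent comparison and the endgame
  have hexpo : C₀ * (Real.log H + (A : ℝ) ^ N) ≤ C₀ * ℓ + C₀ * d₁ * 1 * A + C₀ * 1 ^ N * (A : ℝ) ^ N := by
    have h2 : Real.log H + (A : ℝ) ^ N ≤ ℓ + d₁ * A + (A : ℝ) ^ N := by
      have : (4 + 4 * (d : ℝ)) * A ≤ d₁ * A := by rw [hd₁]; nlinarith
      linarith
    calc C₀ * (Real.log H + (A : ℝ) ^ N) ≤ C₀ * (ℓ + d₁ * A + (A : ℝ) ^ N) := mul_le_mul_of_nonneg_left h2 hC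
      _ = _ := by ring
  have hrest : d * A + 3 * A * R₁ + 2 * d * A ≤ d₁ * A := by rw [hd₁]; nlinarith
  have hfinal : (A : ℝ) ^ m ≤ C₀ * ℓ + C₀ * d₁ * 1 * A + C₀ * 1 ^ N * (A : ℝ) ^ N + d₁ * A + K₁ := by
    rw [hK₁]; linarith
  exact absurd hfinal (not_le.mpr (engine_endgame hC hℓ0 hd₁0 zero_le_one hK₁0 hΓ hk hb2 (by omega)))

end Engine

end Summit.Schanuel.Schanuel.Theorems.RootDecomp1BQuadFrame

end
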